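import Literature.Analysis.FluidPDE.TorusNSVorticityLsCriterion
import Literature.Analysis.FluidPDE.TorusVorticityMomentBalance
import Literature.Analysis.FunctionSpaces.TorusDiffMonomialBounds
import HarnessLib

/-!
# FunctionalMining — K0 row `E.q=4|T_LD|G1`, step 1: the stretching production of `∫|ω|⁴`

Search for candidate a priori estimates; no regularity claim.

Toward the K0 row `E.q=4|T_LD|G1` (`Z₄ = ∫_{T³}|ω|⁴`; no-go seat SIEVELD §3.2, Theorem G:
HOLDS ∃κ on paper) as a kernel theorem. The tree's exact `Z₄` balance
(`IsClassicalNSSolutionOn.hasDerivWithinAt_integral_torusVorticitySqAt_pow`, `m = 2`) has the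
production `4∫|ω|²σ`, `σ = torusStretchingDensity = −∑ᵢⱼ Wᵢⱼ (∇u ∇u)ᵢⱼ`. This file bounds it by
Cauchy–Schwarz only:

* pointwise `σ² ≤ 2|ω|² · |∇u|⁴_F` (`stretchingDensity_sq_le`; `|∇u|²_F = ∑ₖ‖∂ₖu‖²`,
  `∑ᵢⱼWᵢⱼ² = 2|ω|²`, Frobenius submultiplicativity `|AA|_F ≤ |A|²_F`);
* `(∫|ω|²σ)² ≤ 2 (∫|ω|⁴) ∫|ω|²|∇u|⁴_F` and `(∫|ω|²|∇u|⁴_F)² ≤ (∫|ω|⁴) ∫|∇u|⁸_F`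
  (`stretching_integral_sq_le`, `weighted_gradPow_sq_le`);
* on `T³ = UnitAddTorus (Fin 3)`: `|ω|² = ‖curl u‖²` for the tree's `BDSV.curl`
  (`norm_curl_sq`), `∫ curl u = 0` (`hasZeroMean_curl`), and
  `∑ₖ∑ᵢⱼ(∂ₖWᵢⱼ)² = 2∑ₖ‖∂ₖ curl u‖²` (`sum_partialDeriv_vorticityTensor_sq`), which identify the
  viscous term of the balance with `2∫‖ω‖²∑ₖ‖∂ₖω‖²`, `ω = curl u` a smooth zero-mean vector field —
  so that the explicit nonlinear Poincaré inequality and the interpolation lemmas of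
  `VelocityL4*` apply to `ω` verbatim.
-/

noncomputable section

open MeasureTheory Finset Set
open scoped InnerProductSpace RealInnerProductSpace ContDiff

namespace Summit.NavierStokesRegularity.FunctionalMining

open Literature.Analysis.FunctionSpaces Literature.Analysis.FunctionSpaces.Torus
  Literature.Analysis.FluidPDE

namespace VorticityL4

variable {d : Type*} [Fintype d] [DecidableEq d]

/-! ## 1. Pointwise algebra (every dimension) -/

/-- `‖∂ₖv(x)‖² = ∑ⱼ (∂ₖv(x))ⱼ²`. [folklore] -/
theorem norm_partialDeriv_sq_eq_sum (v : UnitAddTorus d → EuclideanSpace ℝ d) (k : d)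
    (x : UnitAddTorus d) : ‖partialDeriv k v x‖ ^ 2 = ∑ j, partialDeriv k v x j ^ 2 := by
  rw [EuclideanSpace.norm_sq_eq]
  exact Finset.sum_congr rfl fun j _ => by rw [Real.norm_eq_abs, sq_abs]

/-- `∑ᵢⱼ Wᵢⱼ(x)² = 2|ω(x)|²` (definitional). [folklore] -/
theorem sum_vorticityTensor_sq (v : UnitAddTorus d → EuclideanSpace ℝ d) (x : UnitAddTorus d) :
    ∑ i, ∑ j, torusVorticityTensor v i j x ^ 2 = 2 * torusVorticitySqAt v x := by
  simp only [torusVorticitySqAt, torusVorticityTensor]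
  ring

/-- **Pointwise Cauchy–Schwarz bound of the stretching density:**
`σ(x)² ≤ 2|ω(x)|² (∑ₖ‖∂ₖv(x)‖²)²` — `σ = −⟪W, (∇v)(∇v)⟫_F`, `|⟪W, M⟫| ≤ |W|_F|M|_F`,
`|(∇v)(∇v)|_F ≤ |∇v|²_F`, `|W|²_F = 2|ω|²`. Every dimension, no divergence condition. [ours; elementary] -/
theorem stretchingDensity_sq_le (v : UnitAddTorus d → EuclideanSpace ℝ d) (x : UnitAddTorus d) :
    torusStretchingDensity v x ^ 2 ≤
      2 * torusVorticitySqAt v x * (∑ k, ‖partialDeriv k v x‖ ^ 2) ^ 2 := by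
  set a : d → d → ℝ := fun i k => partialDeriv i v x k with ha
  set W : d → d → ℝ := fun i j => torusVorticityTensor v i j x with hW
  set M : d → d → ℝ := fun i j => ∑ k, a i k * a k j with hM
  have hσ : torusStretchingDensity v x = -∑ i, ∑ j, W i j * M i j := rfl
  -- `g = ∑ₖ‖∂ₖv‖² = ∑ᵢₖ aᵢₖ²`
  have hg : ∑ k, ‖partialDeriv k v x‖ ^ 2 = ∑ i, ∑ k, a i k ^ 2 :=
    Finset.sum_congr rfl fun i _ => norm_partialDeriv_sq_eq_sum v i x
  -- Cauchy–Schwarz over the index pairs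
  have hCS : (∑ i, ∑ j, W i j * M i j) ^ 2 ≤ (∑ i, ∑ j, W i j ^ 2) * ∑ i, ∑ j, M i j ^ 2 := by
    rw [← Fintype.sum_prod_type' (fun i j => W i j * M i j),
      ← Fintype.sum_prod_type' (fun i j => W i j ^ 2), ← Fintype.sum_prod_type' (fun i j => M i j ^ 2)]
    exact Finset.sum_mul_sq_le_sq_mul_sq _ _ _
  -- `∑ᵢⱼ Mᵢⱼ² ≤ g²`
  have hMij : ∀ i j, M i j ^ 2 ≤ (∑ k, a i k ^ 2) * ∑ k, a k j ^ 2 := fun i j =>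
    Finset.sum_mul_sq_le_sq_mul_sq _ _ _
  have hM2 : ∑ i, ∑ j, M i j ^ 2 ≤ (∑ i, ∑ k, a i k ^ 2) ^ 2 := by
    calc ∑ i, ∑ j, M i j ^ 2 ≤ ∑ i, ∑ j, (∑ k, a i k ^ 2) * ∑ k, a k j ^ 2 :=
          Finset.sum_le_sum fun i _ => Finset.sum_le_sum fun j _ => hMij i j
      _ = (∑ i, ∑ k, a i k ^ 2) * ∑ j, ∑ k, a k j ^ 2 := by
          rw [Finset.sum_mul_sum]
      _ = (∑ i, ∑ k, a i k ^ 2) * ∑ k, ∑ j, a k j ^ 2 := by rw [Finset.sum_comm (f := fun j k => a k j ^ 2)]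
      _ = (∑ i, ∑ k, a i k ^ 2) ^ 2 := by ring
  have hW2 : ∑ i, ∑ j, W i j ^ 2 = 2 * torusVorticitySqAt v x := sum_vorticityTensor_sq v x
  have hω0 : 0 ≤ 2 * torusVorticitySqAt v x := mul_nonneg (by norm_num) (torusVorticitySqAt_nonneg v x)
  rw [hσ, neg_sq, hg]
  calc (∑ i, ∑ j, W i j * M i j) ^ 2 ≤ (∑ i, ∑ j, W i j ^ 2) * ∑ i, ∑ j, M i j ^ 2 := hCS
    _ ≤ (2 * torusVorticitySqAt v x) * (∑ i, ∑ k, a i k ^ 2) ^ 2 := by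
        rw [hW2]; exact mul_le_mul_of_nonneg_left hM2 hω0

/-! ## 2. Continuity of the slice quantities -/

/-- `x ↦ Wᵢⱼ(x)` is continuous for smooth `v`. [folklore] -/
theorem continuous_vorticityTensor {v : UnitAddTorus d → EuclideanSpace ℝ d} (hv : IsSmooth v)
    (i j : d) : Continuous (torusVorticityTensor v i j) :=
  (((hv.partialDeriv i).apply j).sub ((hv.partialDeriv j).apply i)).continuous

/-- `x ↦ |ω(x)|²` is continuous for smooth `v`. [folklore] -/
theorem continuous_vorticitySqAt {v : UnitAddTorus d → EuclideanSpace ℝ d} (hv : IsSmooth v) :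
    Continuous (torusVorticitySqAt v) := by
  have h : Continuous fun x => 2⁻¹ * ∑ i, ∑ j, torusVorticityTensor v i j x ^ 2 :=
    continuous_const.mul (continuous_finsetSum _ fun i _ => continuous_finsetSum _ fun j _ =>
      (continuous_vorticityTensor hv i j).pow 2)
  convert h using 1
  funext x
  have := sum_vorticityTensor_sq v x
  linarith

/-- `x ↦ ∑ₖ‖∂ₖv(x)‖²` is continuous for smooth `v`. [folklore] -/
theorem continuous_gradSq {v : UnitAddTorus d → EuclideanSpace ℝ d} (hv : IsSmooth v) :
    Continuous fun x => ∑ k, ‖partialDeriv k v x‖ ^ 2 :=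
  continuous_finsetSum _ fun k _ => ((hv.partialDeriv k).continuous.norm).pow 2

/-- `x ↦ σ(x)` is continuous for smooth `v`. [folklore] -/
theorem continuous_stretchingDensity {v : UnitAddTorus d → EuclideanSpace ℝ d} (hv : IsSmooth v) :
    Continuous (torusStretchingDensity v) := by
  have ha : ∀ i k, Continuous fun x => partialDeriv i v x k := fun i k =>
    ((hv.partialDeriv i).apply k).continuous
  unfold torusStretchingDensity
  exact (continuous_finsetSum _ fun i _ => continuous_finsetSum _ fun j _ =>
    (continuous_vorticityTensor hv i j).mul
      (continuous_finsetSum _ fun k _ => (ha i k).mul (ha k j))).neg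

/-! ## 3. Cauchy–Schwarz in `L²(T^d)` for the two production factors -/

/-- **`(∫|ω|²σ)² ≤ 2 (∫|ω|⁴) ∫|ω|² (∑ₖ‖∂ₖv‖²)²`** for smooth `v` on `T^d` (Cauchy–Schwarz and
`stretchingDensity_sq_le`). [ours] -/
theorem stretching_integral_sq_le {v : UnitAddTorus d → EuclideanSpace ℝ d} (hv : IsSmooth v) :
    (∫ x, torusVorticitySqAt v x * torusStretchingDensity v x) ^ 2 ≤
      2 * (∫ x, torusVorticitySqAt v x ^ 2) *
        ∫ x, torusVorticitySqAt v x * (∑ k, ‖partialDeriv k v x‖ ^ 2) ^ 2 := by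
  have hω := continuous_vorticitySqAt hv
  have hσ := continuous_stretchingDensity hv
  have hg := continuous_gradSq hv
  have h1 := sq_integral_mul_le hω hσ
  have h2 : ∫ x, torusStretchingDensity v x ^ 2 ≤
      ∫ x, 2 * torusVorticitySqAt v x * (∑ k, ‖partialDeriv k v x‖ ^ 2) ^ 2 := by
    refine integral_mono_of_nonneg (ae_of_all _ fun x => sq_nonneg _) ?_
      (ae_of_all _ fun x => stretchingDensity_sq_le v x)
    exact ((continuous_const.mul hω).mul (hg.pow 2)).integrable_of_hasCompactSupport
      (HasCompactSupport.of_compactSpace _)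
  have h3 : ∫ x, 2 * torusVorticitySqAt v x * (∑ k, ‖partialDeriv k v x‖ ^ 2) ^ 2 =
      2 * ∫ x, torusVorticitySqAt v x * (∑ k, ‖partialDeriv k v x‖ ^ 2) ^ 2 := by
    rw [← integral_const_mul]
    exact integral_congr_ae (ae_of_all _ fun x => by ring)
  have hA : 0 ≤ ∫ x, torusVorticitySqAt v x ^ 2 := integral_nonneg fun x => sq_nonneg _
  calc (∫ x, torusVorticitySqAt v x * torusStretchingDensity v x) ^ 2
      ≤ (∫ x, torusVorticitySqAt v x ^ 2) * ∫ x, torusStretchingDensity v x ^ 2 := h1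
    _ ≤ (∫ x, torusVorticitySqAt v x ^ 2) *
        (2 * ∫ x, torusVorticitySqAt v x * (∑ k, ‖partialDeriv k v x‖ ^ 2) ^ 2) := by
        rw [← h3]; exact mul_le_mul_of_nonneg_left h2 hA
    _ = _ := by ring

/-- **`(∫|ω|²(∑ₖ‖∂ₖv‖²)²)² ≤ (∫|ω|⁴) ∫(∑ₖ‖∂ₖv‖²)⁴`** for smooth `v` on `T^d` (Cauchy–Schwarz). [ours] -/
theorem weighted_gradPow_sq_le {v : UnitAddTorus d → EuclideanSpace ℝ d} (hv : IsSmooth v) :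
    (∫ x, torusVorticitySqAt v x * (∑ k, ‖partialDeriv k v x‖ ^ 2) ^ 2) ^ 2 ≤
      (∫ x, torusVorticitySqAt v x ^ 2) * ∫ x, (∑ k, ‖partialDeriv k v x‖ ^ 2) ^ 4 := by
  have h := sq_integral_mul_le (f := torusVorticitySqAt v)
    (g := fun x => (∑ k, ‖partialDeriv k v x‖ ^ 2) ^ 2) (continuous_vorticitySqAt hv)
    ((continuous_gradSq hv).pow 2)
  have e : ∫ x, ((∑ k, ‖partialDeriv k v x‖ ^ 2) ^ 2) ^ 2 = ∫ x, (∑ k, ‖partialDeriv k v x‖ ^ 2) ^ 4 :=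
    integral_congr_ae (ae_of_all _ fun x => by ring)
  rw [e] at h
  exact h

/-! ## 4. `T³`: the vorticity vector `curl u` -/

/-- On `T³`, `‖curl v(x)‖² = |ω(x)|²` (`torusVorticitySqAt`) for the tree's `BDSV.curl`. [folklore] -/
theorem norm_curl_sq (v : UnitAddTorus (Fin 3) → EuclideanSpace ℝ (Fin 3)) (x : UnitAddTorus (Fin 3)) :
    ‖BDSV.curl v x‖ ^ 2 = torusVorticitySqAt v x := by
  rw [torusVorticitySqAt_eq_sum_curl_sq, EuclideanSpace.norm_sq_eq]
  exact Finset.sum_congr rfl fun l _ => by rw [Real.norm_eq_abs, sq_abs]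

/-- On `T³`, `∫ curl v = 0` for smooth `v` (each component is a difference of partial derivatives of
periodic functions). [folklore] -/
theorem hasZeroMean_curl {v : UnitAddTorus (Fin 3) → EuclideanSpace ℝ (Fin 3)} (hv : IsSmooth v) :
    HasZeroMean (BDSV.curl v) := by
  have hint : ∀ j k : Fin 3, ∫ y, partialDeriv j v y k = 0 := fun j k => by
    have h := integral_partialDeriv_eq_zero_holds (hv.apply k) j
    simp_rw [partialDeriv_apply_coord (hv.isContDiff (by simp))] at h
    exact h
  have hI : ∀ j k : Fin 3, Integrable (fun y => partialDeriv j v y k) volume := fun j k =>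
    ((hv.partialDeriv j).apply k).integrable
  have hcomp : ∀ l : Fin 3, ∫ y, BDSV.curl v y l = 0 := by
    intro l
    fin_cases l
    · show ∫ y, BDSV.curl v y 0 = 0
      simp only [BDSV.curl_apply_zero]
      rw [integral_sub (hI 1 2) (hI 2 1), hint, hint, sub_zero]
    · show ∫ y, BDSV.curl v y 1 = 0
      simp only [BDSV.curl_apply_one]
      rw [integral_sub (hI 2 0) (hI 0 2), hint, hint, sub_zero]
    · show ∫ y, BDSV.curl v y 2 = 0
      simp only [BDSV.curl_apply_two]
      rw [integral_sub (hI 0 1) (hI 1 0), hint, hint, sub_zero]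
  have hωI : Integrable (BDSV.curl v) volume := (BDSV.isSmooth_curl hv).integrable
  unfold HasZeroMean
  have h : ∀ l : Fin 3, (∫ y, BDSV.curl v y) l = 0 := fun l => by
    rw [show (∫ y, BDSV.curl v y) l =
        (EuclideanSpace.proj l : EuclideanSpace ℝ (Fin 3) →L[ℝ] ℝ) (∫ y, BDSV.curl v y) from rfl,
      ← ContinuousLinearMap.integral_comp_comm _ hωI]
    exact hcomp l
  ext l
  rw [h l]
  rfl

/-- On `T³`, for smooth `v` and every direction `k`,
`∑ᵢⱼ (∂ₖWᵢⱼ(x))² = 2 ‖∂ₖ(curl v)(x)‖²` (the six off-diagonal entries of `W` are `±` the three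
components of `curl v`). [folklore] -/
theorem sum_partialDeriv_vorticityTensor_sq {v : UnitAddTorus (Fin 3) → EuclideanSpace ℝ (Fin 3)}
    (hv : IsSmooth v) (k : Fin 3) (x : UnitAddTorus (Fin 3)) :
    ∑ i, ∑ j, partialDeriv k (torusVorticityTensor v i j) x ^ 2 =
      2 * ‖partialDeriv k (BDSV.curl v) x‖ ^ 2 := by
  have hω : IsSmooth (BDSV.curl v) := BDSV.isSmooth_curl hv
  have hcomp : ∀ l : Fin 3, partialDeriv k (BDSV.curl v) x l =
      partialDeriv k (fun y => BDSV.curl v y l) x := fun l =>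
    (partialDeriv_apply_coord (hω.isContDiff (by simp)) k x l).symm
  -- the components of `curl v` as entries of `W`
  have h0 : (fun y => BDSV.curl v y 0) = torusVorticityTensor v 1 2 := by
    funext y; rw [BDSV.curl_apply_zero]; rfl
  have h1 : (fun y => BDSV.curl v y 1) = torusVorticityTensor v 2 0 := by
    funext y; rw [BDSV.curl_apply_one]; rfl
  have h2 : (fun y => BDSV.curl v y 2) = torusVorticityTensor v 0 1 := by
    funext y; rw [BDSV.curl_apply_two]; rfl
  -- antisymmetry and vanishing diagonal under `∂ₖ`
  have hswap : ∀ i j, partialDeriv k (torusVorticityTensor v j i) x =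
      -partialDeriv k (torusVorticityTensor v i j) x := by
    intro i j
    have e : torusVorticityTensor v j i = fun y => (-1 : ℝ) * torusVorticityTensor v i j y := by
      funext y; rw [torusVorticityTensor_swap]; ring
    rw [e, partialDeriv_const_mul]; ring
  have hdiag : ∀ i, partialDeriv k (torusVorticityTensor v i i) x = 0 := by
    intro i
    have := hswap i i
    linarith
  rw [EuclideanSpace.norm_sq_eq]
  simp only [Real.norm_eq_abs, sq_abs, Fin.sum_univ_three, hcomp, h0, h1, h2, hdiag,
    hswap 1 0, hswap 2 0, hswap 2 1]
  ring

/-- On `T³`, the first viscous term of the `Z₄` balance is twice the weighted gradient integral of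
`ω = curl v`: `∫|ω|²∑ₖ∑ᵢⱼ(∂ₖWᵢⱼ)² = 2∫‖ω‖²∑ₖ‖∂ₖω‖²`. [folklore] -/
theorem viscous_term_eq {v : UnitAddTorus (Fin 3) → EuclideanSpace ℝ (Fin 3)} (hv : IsSmooth v) :
    ∫ x, torusVorticitySqAt v x *
        ∑ k, ∑ i, ∑ j, partialDeriv k (torusVorticityTensor v i j) x ^ 2 =
      2 * ∫ x, ‖BDSV.curl v x‖ ^ 2 * ∑ k, ‖partialDeriv k (BDSV.curl v) x‖ ^ 2 := by
  rw [← integral_const_mul]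
  refine integral_congr_ae (ae_of_all _ fun x => ?_)
  simp only [sum_partialDeriv_vorticityTensor_sq hv, norm_curl_sq]
  rw [← Finset.mul_sum]
  ring

end VorticityL4

end Summit.NavierStokesRegularity.FunctionalMining
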